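/-
Origin: expansion seat `planner-pub-hodgecm-pv08-g3-0`, handover #1 2026-08-18T05:27:53Z (`HOME/pub-hodgecm-pv08-g3/lean/Pv08g3/S4Strength.lean`, md5 e917788a, 629 lines);
landed by the gen-6 packager in gate run 23 as `HodgeCM/PerL34/S4Strength.lean` (verbatim).
-/
/-
pub-hodgecm cell — DAG-NODE PROVER #08 gen 3 (session planner-pub-hodgecm-pv08-g3-0, unit pub-hodgecm-pv08-g3).
WIP module `Pv08g3.S4Strength`; proposed final place `HodgeCM/PerL34/S4Strength.lean`
(module `HodgeCM.PerL34.S4Strength`).  Imports the LANDED `HodgeCM.PerL34.ArchC` (pv06, node N29, gate runs 18/21)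
only.  Nothing is posited, nothing is cited; no mathematics of [PerL] is proved or refuted here.

`S4Strength`: the junk-instance / STRENGTH test of seam S4 of LEMMAS.md §9 asked for by referee A
(REFEREE.md round 15, proposal P1: "run the junk-instance test of `SeamVacuity` on `ArchCDatum` (seam S4) …:
either a theorem `Nonempty (ArchCDatum …) ↔ …` under a non-triviality hypothesis, or a genuine extra-strength
witness; until then the DATA binders of `perL_of_leaves'` are interfaces of UNKNOWN strength relative to the
open inputs"), in the format of carver-g2's `SeamVacuity.lean` (seam S3: `ClusterOutputs T ↔ T.Open_chars`,
CONSERVATIVE) and pv08-g2's `S5Conservative(Qaut).lean` (seam S5: `Nonempty (SeesawBridge …) ↔ N19w_genIdentity …`,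
CONSERVATIVE).

ANSWER FOR S4 (all kernel-checked below): the binder
  `A12 : ∀ V c, T.GoodCtx ι₁ c → Nonempty (ArchCDatum (T.core V c) (T.t12 V c) (Pc V c))`   (and `A34`)
of `Universe.ThetaModel.Open_occ_of_archC` (ArchC.lean) — alias h29 of `AssemblyLeaves.perL_of_leaves'` — is
**NOT conservative** over the open input `T.Open_occ` it feeds, and its excess is located exactly:

(1) `ArchCCore C P` := the part of `ArchCDatum C D P` that does not mention the torus side `D` — this is EVERY
    field except the last one, `wOccurs_of_eigenvector`.  Definitionally
      `Nonempty (ArchCDatum C D P) ↔ ∃ K : ArchCCore C P, ∀ i, K.Eigen i → D.wOccurs i`         (`nonempty_iff_core`)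
    where `K.Eigen i` := "σ̂_i contains a non-zero joint eigenvector of the chart's torus `K.ιT(K.Tg)` with
    character `K.w`"; and `Detected C i → K.Eigen i` for every chart (`ArchCCore.eigen_of_detected`, the landed
    inference ll. 513–523 re-run D-free), so binder ⇒ leaf is recovered (`occLeaf_of_nonempty` = `ArchCDatum.H_occ`).
(2) GENUINE EXTRA STRENGTH (core side): `Nonempty (ArchCDatum C D P)` implies the D-free, `Open_occ`-free facts
    `Invariance C` (node N21 verbatim) and `Nonempty (ArchCCore C P)`; and the latter FAILS on the Prior programme's
    own one-point model although the leaf and N21 hold there: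
      `IsEmpty (ArchCCore SmokeS4.core P)` for every pointed extension `P`, hence
      `IsEmpty (ArchCDatum SmokeS4.core D P)` for every torus side `D` (in particular for `SmokeS4.torus`, whose
      `wOccurs ≡ True` makes the leaf hold) — the obstruction is `ins_smul` + `pure_detect`: the index type `SK`
      must carry, through `Φ ↦ 𝒯_Φ`, complex LINES through every detecting kernel ([SETUP D4] "Φ ↦ 𝒯_Φ is linear"),
      which `SK = Unit, 𝒯 = id` does not (cf. pv12-g3, STATUS 05:18:52Z: "EXCLUDE Prior's one-point smoke").
    So, unlike S3/S5, no theorem `Nonempty (ArchCDatum C D P) ↔ <leaf>` can hold without hypotheses on the core.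
(3) JUNK UPPER BOUND (torus side): from three elementary D-free facts of the intended model — `Invariance C` (N21),
    `ScalarClosed C` ("c·𝒯_Φ is again some 𝒯_{Φ'}", i.e. 𝒮^κ is closed under scalars and 𝒯 is homogeneous) and
    `OmgOne C` (ω(1) = id on 𝒮^κ) — a JUNK chart `ArchCCore.junk` is built with `F := ℂ`, `φ⁰ := 1`, NO Lie algebra
    directions (`ιX := ∅`, so `gen`, `inf_invariance`, `Y_mem` are trivial), `Sm i := σ̂_i` (Gårding package
    trivial) and the TRIVIAL torus `Tg := PUnit`, `w := 1`; its eigenvector predicate is `σ̂_i ≠ ⊥`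
    (`junk_eigen_iff`).  Consequently
      `Invariance C → ScalarClosed C → OmgOne C → (∀ i, C.hatσ i ≠ ⊥ → D.wOccurs i) → Nonempty (ArchCDatum C D P)`
    (`nonempty_of_strongOcc`): modulo core set-up the binder is implied by the STRONG occurrence statement
    "w occurs in EVERY non-zero isotypic component", and implies the leaf "w occurs in every 𝒯-DETECTED component".
    The honest torus `T(L₀⊗ℝ)` with the honest type `w` (pv12-g2 / pv12-g3's Fock bridge `ArchCFock(Analytic)`) sits
    between the two and is invisible to the typed cone — this is the CAVEAT of the `ArchCDatum` docstring
    ("a junk instantiation (e.g. `Tg` trivial, `w = 1`) would turn `wOccurs_of_eigenvector` into an unrelated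
    strong claim"), now a kernel theorem, and it says precisely which labelled hypotheses of the S4 record carry
    logical (as opposed to documentary) weight: N21 `invariance` and the linearity chart `ins_add/ins_smul/
    pure_detect` DO (they fail on junk cores); N28 `gen/φ₀_eigen`, the Gårding package `Sm_*/Y_mem/inf_invariance`
    and `omg_ins` DO NOT (the junk chart discharges them from `OmgOne` alone); `wOccurs_of_eigenvector` carries
    exactly the torus DICTIONARY.
(4) The third binder `Pc : ∀ V c, C4a.PointedCore (T.core V c)` of `Open_occ_of_archC` carries NO strength:
    `C4a.PointedCore C` is inhabited for every core (`PointedCore.ofDual`: points := the continuous dual of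
    `C([G_U])`, separation = Hahn–Banach, Mathlib `SeparatingDual`).
(5) Model level (`Universe.ThetaModel` namespace): the binder-shaped statements `archC_binder_iff_core`,
    `archC_binder_of_strongOcc`, `open_occ_of_strongOcc` and `pointedCores T` restate (1)–(4) in the literal binder
    shapes of `Open_occ_of_archC`.

MEANING (for the carver's binder census LEMMAS §2 v8 (1), the writer's FACTS §0 'LEAF WIRING IS TYPE-LEVEL' and
referee A r15 G2/P1; not an objection): h29 must NOT be glossed as '≡ Open_occ' (as h31 ≡ Open_chars may be): it is
Open_occ-strength PLUS D-free core set-up (N21 + linearity of 𝒯 on an honest Schwartz index) PLUS the definitional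
torus dictionary; the set-up part is what pv12-g3's `FockAnalyticBridge` instantiates honestly, and the cone cannot
distinguish that honest instance from `ArchCCore.junk`.
-/
import Summits.HodgeConjecture.HodgeCM.PerL34.ArchC_2

set_option autoImplicit false

noncomputable section

namespace HodgeCM

namespace PerL34.ArchC

open HodgeCM.Prior.Perl34File HodgeCM.Prior.Perl34File.Perl34

section Core

variable {H HG CG G SK SigIdx SigIdxG : Type*}
variable [NormedAddCommGroup H] [InnerProductSpace ℂ H] [CompleteSpace H]
variable [NormedAddCommGroup HG] [InnerProductSpace ℂ HG] [CompleteSpace HG]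
variable [NormedAddCommGroup CG] [NormedSpace ℂ CG]
variable [Group G] [TopologicalSpace G] [TopologicalSpace SK]

/-! ## The vocabulary of the test -/

/-- The LEAF fed by seam S4: Lemma 4.1(c) in the shape of the frozen `IsolationSetting.H_occ12/34` / one half of
prl1's `ThetaModel.Open_occ` in one context — "every 𝒯-detected isotypic component has `wOccurs`"
(= the conclusion of `ArchCDatum.H_occ`). -/
def OccLeaf (C : IsolationCore H HG CG G SK SigIdx SigIdxG) (D : TorusData C) : Prop :=
  ∀ (Φ : SK) (i : SigIdx), (∃ v ∈ C.hatσ i, C.TΦ Φ v ≠ 0) → D.wOccurs i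

/-- The STRONG occurrence statement: every non-zero isotypic component has `wOccurs`. -/
def StrongOcc (C : IsolationCore H HG CG G SK SigIdx SigIdxG) (D : TorusData C) : Prop :=
  ∀ i : SigIdx, C.hatσ i ≠ ⊥ → D.wOccurs i

/-- [NODE N21] as a property of the core alone (tex l. 382–383): 𝒯_{ω(h)Φ}(R(h)v) = 𝒯_Φ(v) — verbatim the
field `ArchCDatum.invariance`. -/
def Invariance (C : IsolationCore H HG CG G SK SigIdx SigIdxG) : Prop :=
  ∀ (h : G) (Φ : SK) (v : H), C.TΦc (C.omg h Φ) (C.R h v) = C.TΦc Φ v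

/-- [SETUP D4, elementary] the range of Φ ↦ 𝒯_Φ is closed under scalars: for the intended `SK = 𝒮^κ` (a complex
vector space) and the linear Φ ↦ 𝒯_Φ, take Φ' := c·Φ. -/
def ScalarClosed (C : IsolationCore H HG CG G SK SigIdx SigIdxG) : Prop :=
  ∀ (c : ℂ) (Φ : SK), ∃ Φ' : SK, C.TΦc Φ' = c • C.TΦc Φ

/-- [SETUP, elementary] ω(1) = id on 𝒮^κ (the frozen `omg` is a bare function; its unit law is semantic). -/
def OmgOne (C : IsolationCore H HG CG G SK SigIdx SigIdxG) : Prop :=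
  ∀ Φ : SK, C.omg 1 Φ = Φ

/-- The strong statement implies the leaf (a detected component is non-zero). -/
theorem occLeaf_of_strongOcc {C : IsolationCore H HG CG G SK SigIdx SigIdxG} {D : TorusData C}
    (h : StrongOcc C D) : OccLeaf C D := by
  intro Φ i ⟨v, hv, hTv⟩
  refine h i ((Submodule.ne_bot_iff _).mpr ⟨v, hv, ?_⟩)
  rintro rfl
  exact hTv (map_zero _)

/-! ## (1) The D-free part of the S4 record -/

/-- **The D-free part of `ArchCDatum C D P`**: literally every field of the landed record (ArchC.lean, Layer C)
except the last one, `wOccurs_of_eigenvector` — the only field that mentions the torus side `D`.  Field names,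
types and order are those of `ArchCDatum`; see there for the honest-split labels and print references. -/
structure ArchCCore (C : IsolationCore H HG CG G SK SigIdx SigIdxG) (P : C4a.PointedCore C) where
  F : Type
  [instACG : AddCommGroup F]
  [instMod : Module ℂ F]
  ιX : Type
  X : ιX → F →ₗ[ℂ] F
  Tg : Type
  [instGrp : Group Tg]
  ιT : Tg →* G
  w : Tg →* ℂ
  w_norm : ∀ t, ‖w t‖ = 1
  ωT : Tg → F →ₗ[ℂ] F
  FinIdx : Type
  ins : FinIdx → F → SK
  φ₀ : F
  Sm : SigIdx → Set H
  Y : ιX → H → H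
  ins_add : ∀ (f : FinIdx) (φ ψ : F), C.TΦc (ins f (φ + ψ)) = C.TΦc (ins f φ) + C.TΦc (ins f ψ)
  ins_smul : ∀ (f : FinIdx) (c : ℂ) (φ : F), C.TΦc (ins f (c • φ)) = c • C.TΦc (ins f φ)
  omg_ins : ∀ (f : FinIdx) (t : Tg) (φ : F), C.omg (ιT t) (ins f φ) = ins f (ωT t φ)
  invariance : ∀ (h : G) (Φ : SK) (v : H), C.TΦc (C.omg h Φ) (C.R h v) = C.TΦc Φ v
  pure_detect : ∀ (Φ : SK) (p : P.Pt) (v : H), P.evalPt p (C.TΦc Φ v) ≠ 0 →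
    ∃ (f : FinIdx) (φ : F), P.evalPt p (C.TΦc (ins f φ) v) ≠ 0
  Sm_sub : ∀ i, Sm i ⊆ (C.hatσ i : Set H)
  Sm_dense : ∀ i, (C.hatσ i : Set H) ⊆ closure (Sm i)
  Y_mem : ∀ (k : ιX) (i : SigIdx), ∀ v ∈ Sm i, Y k v ∈ Sm i
  inf_invariance : ∀ (f : FinIdx) (p : P.Pt) (k : ιX) (φ : F) (i : SigIdx), ∀ v ∈ Sm i,
    P.evalPt p (C.TΦc (ins f (X k φ)) v) = - P.evalPt p (C.TΦc (ins f φ) (Y k v))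
  gen : ∀ N : Submodule ℂ F, φ₀ ∈ N → (∀ k, ∀ φ ∈ N, X k φ ∈ N) → N = ⊤
  φ₀_eigen : ∀ t : Tg, ωT t φ₀ = (w t)⁻¹ • φ₀

namespace ArchCCore

attribute [instance] ArchCCore.instACG ArchCCore.instMod ArchCCore.instGrp

variable {C : IsolationCore H HG CG G SK SigIdx SigIdxG} {P : C4a.PointedCore C}
variable (K : ArchCCore C P)

/-- The chart's eigenvector predicate: σ̂_i contains a non-zero joint eigenvector of `ιT(Tg)` of character `w`
(the premise of `ArchCDatum.wOccurs_of_eigenvector`, the conclusion of `ArchCDatum.exists_eigenvector`). -/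
def Eigen (i : SigIdx) : Prop :=
  ∃ y ∈ C.hatσ i, y ≠ 0 ∧ ∀ t : K.Tg, C.R (K.ιT t) y = K.w t • y

/-- An eigen component is non-zero. -/
theorem ne_bot_of_eigen {i : SigIdx} (h : K.Eigen i) : C.hatσ i ≠ ⊥ := by
  obtain ⟨y, hy, hy0, -⟩ := h
  exact (Submodule.ne_bot_iff _).mpr ⟨y, hy, hy0⟩

/-- Attach the single D-dependent field: a chart plus the definitional reading `Eigen → wOccurs` IS an
`ArchCDatum`. -/
def toDatum (D : TorusData C) (h : ∀ i, K.Eigen i → D.wOccurs i) : ArchCDatum C D P where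
  F := K.F
  ιX := K.ιX
  X := K.X
  Tg := K.Tg
  ιT := K.ιT
  w := K.w
  w_norm := K.w_norm
  ωT := K.ωT
  FinIdx := K.FinIdx
  ins := K.ins
  φ₀ := K.φ₀
  Sm := K.Sm
  Y := K.Y
  ins_add := K.ins_add
  ins_smul := K.ins_smul
  omg_ins := K.omg_ins
  invariance := K.invariance
  pure_detect := K.pure_detect
  Sm_sub := K.Sm_sub
  Sm_dense := K.Sm_dense
  Y_mem := K.Y_mem
  inf_invariance := K.inf_invariance
  gen := K.gen
  φ₀_eigen := K.φ₀_eigen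
  wOccurs_of_eigenvector := h

/-! ### The inference ll. 513–523 is D-free: `Detected → Eigen` for every chart
(the proofs are those of `ArchCDatum.exists_smooth_ne_zero / covariant / exists_eigenvector`, re-run verbatim
over `ArchCCore`; Layers A and B are the landed Mathlib-only / pure-algebra theorems of ArchC.lean). -/

/-- The restricted pairing B_{f,p}(φ)(v) := 𝒯_{φ⊗Φ_f}(v)(p), linear in φ. -/
def pairing (f : K.FinIdx) (p : P.Pt) : K.F →ₗ[ℂ] (H → ℂ) where
  toFun φ := fun v => P.evalPt p (C.TΦc (K.ins f φ) v)
  map_add' φ ψ := by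
    funext v
    simp only [Pi.add_apply]
    rw [K.ins_add, _root_.add_apply, map_add]
  map_smul' c φ := by
    funext v
    simp only [Pi.smul_apply, RingHom.id_apply]
    rw [K.ins_smul, _root_.smul_apply, map_smul]

/-- (Ported verbatim from the HodgeCMPerL package; no docstring in the source.) -/
theorem exists_smooth_ne_zero (Φ : SK) (i : SigIdx) (p : P.Pt) (v : H) (hv : v ∈ C.hatσ i)
    (h : P.evalPt p (C.TΦc Φ v) ≠ 0) :
    ∃ f : K.FinIdx, ∃ v₁ ∈ K.Sm i, P.evalPt p (C.TΦc (K.ins f K.φ₀) v₁) ≠ 0 := by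
  obtain ⟨f, φ₁, hφ₁⟩ := K.pure_detect Φ p v h
  refine ⟨f, ?_⟩
  by_contra hnone
  have hnone' : ∀ v₁ ∈ K.Sm i, P.evalPt p (C.TΦc (K.ins f K.φ₀) v₁) = 0 := fun v₁ hv₁ => by
    by_contra hne
    exact hnone ⟨v₁, hv₁, hne⟩
  have hvan : ∀ φ : K.F, ∀ u ∈ K.Sm i, K.pairing f p φ u = 0 :=
    pairing_vanishes_of_generator K.X K.Y (K.Sm i) (fun k u hu => K.Y_mem k i u hu)
      (K.pairing f p) (fun k φ u hu => K.inf_invariance f p k φ i u hu) K.φ₀ K.gen hnone'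
  have hcont : Continuous fun u : H => P.evalPt p (C.TΦc (K.ins f φ₁) u) :=
    C4a.pointFunctional_continuous C P _ p
  have hclosed : IsClosed {u : H | P.evalPt p (C.TΦc (K.ins f φ₁) u) = 0} :=
    isClosed_eq hcont continuous_const
  have hsub : closure (K.Sm i) ⊆ {u : H | P.evalPt p (C.TΦc (K.ins f φ₁) u) = 0} :=
    closure_minimal (fun u hu => hvan φ₁ u hu) hclosed
  exact hφ₁ (hsub (K.Sm_dense i hv))

/-- (Ported verbatim from the HodgeCMPerL package; no docstring in the source.) -/
theorem covariant (f : K.FinIdx) (p : P.Pt) (t : K.Tg) (u : H) :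
    P.evalPt p (C.TΦc (K.ins f K.φ₀) (C.R (K.ιT t) u)) =
      K.w t * P.evalPt p (C.TΦc (K.ins f K.φ₀) u) := by
  have hw0 : K.w t ≠ 0 := by
    intro h
    have h1 := K.w_norm t
    rw [h, norm_zero] at h1
    exact zero_ne_one h1
  have hφ : K.ωT t (K.w t • K.φ₀) = K.φ₀ := by
    rw [map_smul, K.φ₀_eigen, smul_smul, mul_inv_cancel₀ hw0, one_smul]
  calc P.evalPt p (C.TΦc (K.ins f K.φ₀) (C.R (K.ιT t) u))
      = P.evalPt p (C.TΦc (K.ins f (K.ωT t (K.w t • K.φ₀))) (C.R (K.ιT t) u)) := by rw [hφ]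
    _ = P.evalPt p (C.TΦc (C.omg (K.ιT t) (K.ins f (K.w t • K.φ₀))) (C.R (K.ιT t) u)) := by
          rw [K.omg_ins]
    _ = P.evalPt p (C.TΦc (K.ins f (K.w t • K.φ₀)) u) := by rw [K.invariance]
    _ = K.w t * P.evalPt p (C.TΦc (K.ins f K.φ₀) u) := by
          rw [K.ins_smul, _root_.smul_apply, map_smul, smul_eq_mul]

/-- **Detected ⊆ Eigen** for every chart: Lemma 4.1(c)'s semantic form, D-free. -/
theorem eigen_of_detected (Φ : SK) (i : SigIdx) (h : ∃ v ∈ C.hatσ i, C.TΦ Φ v ≠ 0) : K.Eigen i := by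
  show ∃ y ∈ C.hatσ i, y ≠ 0 ∧ ∀ t : K.Tg, C.R (K.ιT t) y = K.w t • y
  obtain ⟨v, hv, hTv⟩ := h
  obtain ⟨p, hp⟩ := C4a.exists_evalPt_ne_zero C P (C4a.TΦc_ne_zero C hTv)
  obtain ⟨f, v₁, hv₁, hl⟩ := K.exists_smooth_ne_zero Φ i p v hv hp
  have key := exists_eigenvector_of_covariant_functional (C.R.comp K.ιT)
    (fun t u u' => C.R_unitary (K.ιT t) u u') K.w K.w_norm (C.hatσ i)
    (fun t u hu => C.hatσ_invariant i (K.ιT t) u hu) (C.eσ i) (C.eσ_mem i) (C.eσ_fix i)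
    (C.eσ_selfAdjoint i) (C4a.pointFunctional C P (K.ins f K.φ₀) p)
    (fun t u => K.covariant f p t u) (K.Sm_sub i hv₁) hl
  simpa only [MonoidHom.coe_comp, Function.comp_apply] using key

/-- Hence a chart whose eigen components all have `wOccurs` yields the leaf (through the datum it defines). -/
theorem occLeaf_of_core (D : TorusData C) (h : ∀ i, K.Eigen i → D.wOccurs i) : OccLeaf C D :=
  fun Φ i hd => h i (K.eigen_of_detected Φ i hd)

end ArchCCore

/-- Forget the D-dependent field. -/
def ArchCDatum.toCore {C : IsolationCore H HG CG G SK SigIdx SigIdxG} {D : TorusData C}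
    {P : C4a.PointedCore C} (A : ArchCDatum C D P) : ArchCCore C P where
  F := A.F
  ιX := A.ιX
  X := A.X
  Tg := A.Tg
  ιT := A.ιT
  w := A.w
  w_norm := A.w_norm
  ωT := A.ωT
  FinIdx := A.FinIdx
  ins := A.ins
  φ₀ := A.φ₀
  Sm := A.Sm
  Y := A.Y
  ins_add := A.ins_add
  ins_smul := A.ins_smul
  omg_ins := A.omg_ins
  invariance := A.invariance
  pure_detect := A.pure_detect
  Sm_sub := A.Sm_sub
  Sm_dense := A.Sm_dense
  Y_mem := A.Y_mem
  inf_invariance := A.inf_invariance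
  gen := A.gen
  φ₀_eigen := A.φ₀_eigen

section Iff

variable {C : IsolationCore H HG CG G SK SigIdx SigIdxG} {D : TorusData C} {P : C4a.PointedCore C}

/-- (Ported verbatim from the HodgeCMPerL package; no docstring in the source.) -/
theorem ArchCDatum.toCore_eigen_iff (A : ArchCDatum C D P) (i : SigIdx) :
    A.toCore.Eigen i ↔ ∃ y ∈ C.hatσ i, y ≠ 0 ∧ ∀ t : A.Tg, C.R (A.ιT t) y = A.w t • y :=
  Iff.rfl

/-- **(1) The S4 record, split**: an `ArchCDatum` over `D` is exactly a D-free chart together with the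
definitional reading "eigen components have `wOccurs`". -/
theorem nonempty_iff_core :
    Nonempty (ArchCDatum C D P) ↔ ∃ K : ArchCCore C P, ∀ i, K.Eigen i → D.wOccurs i :=
  ⟨fun ⟨A⟩ => ⟨A.toCore, A.wOccurs_of_eigenvector⟩, fun ⟨K, h⟩ => ⟨K.toDatum D h⟩⟩

/-- LOWER BOUND, part (a): the binder implies the leaf (= the landed `ArchCDatum.H_occ`). -/
theorem occLeaf_of_nonempty (h : Nonempty (ArchCDatum C D P)) : OccLeaf C D :=
  fun Φ i hd => h.elim fun A => A.H_occ Φ i hd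

/-- LOWER BOUND, part (b): the binder implies node N21 for the core — a D-free statement on which the leaf is
silent. -/
theorem invariance_of_nonempty (h : Nonempty (ArchCDatum C D P)) : Invariance C :=
  h.elim fun A => A.invariance

/-- LOWER BOUND, part (c): the binder implies the existence of a D-free chart. -/
theorem nonempty_core_of_nonempty (h : Nonempty (ArchCDatum C D P)) : Nonempty (ArchCCore C P) :=
  h.map ArchCDatum.toCore

/-- UPPER BOUND (general form): ANY chart plus the STRONG occurrence statement gives the binder — because every
eigen component is non-zero. -/
theorem nonempty_of_core_of_strongOcc (K : ArchCCore C P) (h : StrongOcc C D) : Nonempty (ArchCDatum C D P) :=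
  ⟨K.toDatum D fun _ he => h _ (K.ne_bot_of_eigen he)⟩

end Iff

end Core

/-! ## (4) The `Pc` binder is free: every core has a pointed extension -/

section Pointed

variable {H HG G SK SigIdx SigIdxG : Type*} {CG : Type}
variable [NormedAddCommGroup H] [InnerProductSpace ℂ H] [CompleteSpace H]
variable [NormedAddCommGroup HG] [InnerProductSpace ℂ HG] [CompleteSpace HG]
variable [NormedAddCommGroup CG] [NormedSpace ℂ CG]
variable [Group G] [TopologicalSpace G] [TopologicalSpace SK]

/-- `C4a.PointedCore C` is inhabited for EVERY core (with `C([G_U])` in `Type`, as in every `ThetaModel`):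
points := the continuous dual of `C([G_U])`, evaluation := application; separation is Hahn–Banach (Mathlib
`SeparatingDual` for normed spaces over `ℂ`).  So the binder `Pc` of `Open_occ_of_archC` carries no logical
strength.  (The INTENDED instance is the point evaluations of the compact quotient `[G_U]`; the record cannot
tell the two apart.) -/
def PointedCore.ofDual (C : IsolationCore H HG CG G SK SigIdx SigIdxG) : C4a.PointedCore C where
  Pt := CG →L[ℂ] ℂ
  evalPt := fun l => l
  evalPt_sep := fun _ h => SeparatingDual.eq_zero_of_forall_dual_eq_zero (R := ℂ) h

/-- (Ported verbatim from the HodgeCMPerL package; no docstring in the source.) -/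
theorem nonempty_pointedCore (C : IsolationCore H HG CG G SK SigIdx SigIdxG) : Nonempty (C4a.PointedCore C) :=
  ⟨PointedCore.ofDual C⟩

end Pointed

/-! ## (3) The junk chart: trivial torus, one-dimensional "Fock space", no directions

(`SK` in `Type`, as in every `ThetaModel`: the record's index fields `F`, `FinIdx`, … live in `Type`.) -/

section Junk

variable {H HG CG G SigIdx SigIdxG : Type*} {SK : Type}
variable [NormedAddCommGroup H] [InnerProductSpace ℂ H] [CompleteSpace H]
variable [NormedAddCommGroup HG] [InnerProductSpace ℂ HG] [CompleteSpace HG]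
variable [NormedAddCommGroup CG] [NormedSpace ℂ CG]
variable [Group G] [TopologicalSpace G] [TopologicalSpace SK]
variable {C : IsolationCore H HG CG G SK SigIdx SigIdxG}

/-- A complex LINE in `SK` through `Φ` as seen by `𝒯`: `𝒯_{line Φ c} = c · 𝒯_Φ` (choice from `ScalarClosed`). -/
def junkLine (hsc : ScalarClosed C) (Φ : SK) (c : ℂ) : SK :=
  Classical.choose (hsc c Φ)

/-- (Ported verbatim from the HodgeCMPerL package; no docstring in the source.) -/
theorem TΦc_junkLine (hsc : ScalarClosed C) (Φ : SK) (c : ℂ) : C.TΦc (junkLine hsc Φ c) = c • C.TΦc Φ :=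
  Classical.choose_spec (hsc c Φ)


-- port_pkg: scope closed for this part
end Junk
end PerL34.ArchC
end HodgeCM
end
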